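import Literature.Computability.Cryptography.VDSCopyLayout
import Literature.Computability.QuantumComplexity.SegmentState
import HarnessLib

/-!
# The van Dam–Seroussi copy, II: the oracle blocks act on register contents

Topic `Literature/Computability/Cryptography`; sequel of `VDSCopyLayout.lean` (the blocks `xblock k`)
and `SegmentState.lean` (labels `lay cfg` from register contents), for the discharge of
`VanDamSeroussi2002_gaussSumPhase_qsolvable`. With the oracle language `VDSOracle.lang₂` and the header
segments holding their constant strings (`HdrOK`), block `k` acts on the label of a content assignment
CLASSICALLY (Bennett–Bernstein–Brassard–Vazirani 1997, Cor. 4.15; Bennett 1973):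

* `VDSCopy.lab P cfg`, `lab_reg`, `ofFn_lab_reg`, `regsBits`, `ofFn_lab_regsEmb`, `HdrOK`,
  `ofFn_lab_hdr` — reading registers, register lists and headers of `lab cfg`;
* `opVal P cfg k` (the value block `k` computes from the contents of its sources: the certificate
  bits for the factoring block, `valOf₂` of the query otherwise), `answer_eq` (the oracle's answer to
  gate `i` is bit `i` of it);
* **`run_xblock_of_clean`** — on contents with a clean target, block `k` WRITES `opVal` into it;
  **`run_xblock_of_written`** — on contents whose target holds `opVal`, block `k` CLEARS it;
  `HdrOK.update` (register updates keep the headers).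

Everything is proved; no named fact.

## References

* C. H. Bennett, E. Bernstein, G. Brassard, U. Vazirani, SIAM J. Comput. 26 (1997), Cor. 4.15 [BennettBernsteinBrassardVazirani1997].
* C. H. Bennett, IBM J. Res. Dev. 17 (1973), §2 [Bennett1973].
* W. van Dam, G. Seroussi, arXiv:quant-ph/0207131 (2002), §4 Algorithm 1 [VanDamSeroussi2002].
-/

noncomputable section

namespace Literature.Computability.Cryptography

namespace VDSCopy

open _root_.Computability Complexity QuantumComplexity QuantumComplexity.SegLayout QuantumComplexity.QFTQubits VDSOracle

variable (P : Prm)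

/-! ### Reading the label of a content assignment -/

/-- **The basis label of register contents** (segment `j` holds `cfg j`). [folklore] -/
def lab (cfg : ℕ → ℕ) : QReg (bw P) := lay (segs := segs P) cfg

/-- Reading a register wire. [folklore] -/
theorem lab_reg (cfg : ℕ → ℕ) (r : R) (i : Fin (wd P r)) : lab P cfg (reg P r i) = (cfg r.idx).testBit i := by
  rw [lab, reg_eq_emb, lay_emb]
  rfl

/-- Reading a register. [folklore] -/
theorem ofFn_lab_reg (cfg : ℕ → ℕ) (r : R) : List.ofFn (lab P cfg ∘ reg P r) = bits (wd P r) (cfg r.idx) := by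
  unfold bits
  congr 1
  funext i
  exact lab_reg P cfg r i

/-- The bits of a list of registers. [folklore] -/
def regsBits (cfg : ℕ → ℕ) : List R → List Bool
  | [] => []
  | r :: l => bits (wd P r) (cfg r.idx) ++ regsBits cfg l

/-- The length of the bits of a register list. [folklore] -/
theorem length_regsBits (cfg : ℕ → ℕ) : ∀ l : List R, (regsBits P cfg l).length = wds P l
  | [] => rfl
  | r :: l => by
    rw [regsBits, List.length_append, length_bits, length_regsBits cfg l]
    rfl

/-- **Reading a register list.** [folklore] -/
theorem ofFn_lab_regsEmb (cfg : ℕ → ℕ) : ∀ (l : List R) (h : l.Nodup), List.ofFn (lab P cfg ∘ regsEmb P l h) = regsBits P cfg l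
  | [], h => ofFn_comp_regsEmb_nil P h _
  | r :: l, h => by
    rw [ofFn_comp_regsEmb_cons, ofFn_lab_reg, ofFn_lab_regsEmb cfg l, regsBits]

/-- **Well-formed headers**: every header segment holds (the value of) its constant string. [folklore] -/
def HdrOK (cfg : ℕ → ℕ) : Prop := ∀ k, k < 26 → ∀ i, i < wd P (op P k).dst → cfg (hdrIdx P k i) = bitsToNat (hdrStr P (op P k) i)

/-- The low bits of the value of a string are the string. [folklore] -/
theorem bits_length_bitsToNat (s : List Bool) : bits s.length (bitsToNat s) = s := by
  apply List.ext_getElem?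
  intro i
  by_cases hi : i < s.length
  · have h1 : (bits s.length (bitsToNat s)).getD i false = s.getD i false := by
      rw [getD_bits, decide_eq_true hi, Bool.true_and, Complexity.testBit_bitsToNat_eq_getD]
    rw [List.getD_eq_getElem?_getD, List.getD_eq_getElem?_getD, List.getElem?_eq_getElem (by simpa using hi),
      List.getElem?_eq_getElem hi] at h1
    rw [List.getElem?_eq_getElem (by simpa using hi), List.getElem?_eq_getElem hi]
    simpa using h1
  · rw [List.getElem?_eq_none (by simpa using hi), List.getElem?_eq_none (by omega)]

variable {P}

/-- **Reading a header** of well-formed contents gives the header string. [folklore] -/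
theorem ofFn_lab_hdr {cfg : ℕ → ℕ} (h : HdrOK P cfg) {k : ℕ} (hk : k < 26) (i : Fin (wd P (op P k).dst)) :
    List.ofFn (lab P cfg ∘ (xblock P k).hdr i) = hdrStr P (op P k) i := by
  show List.ofFn (lay (segs := segs P) cfg ∘ emb (segs P) (hdrIdx P k i)) = _
  rw [ofFn_lay_emb, h k hk i i.isLt, segs_getD_hdrIdx P hk i.isLt, bits_length_bitsToNat]

/-- Register updates keep the headers. [folklore] -/
theorem HdrOK.update {cfg : ℕ → ℕ} (h : HdrOK P cfg) (r : R) (v : ℕ) : HdrOK P (Function.update cfg r.idx v) := by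
  intro k hk i hi
  rw [Function.update_of_ne (fun e => by have := le_hdrIdx P k i; have := R.idx_lt r; omega), h k hk i hi]

/-! ### The value of a block and the oracle's answers -/

variable (P)

/-- **The value block `k` computes** from the contents of its sources: the certificate for the
factoring block, the arithmetic value `valOf₂` of its query otherwise. [cite: VanDamSeroussi2002, §4 Algorithm 1] -/
def opVal (cfg : ℕ → ℕ) (k : ℕ) : ℕ :=
  if (op P k).tag = tagFACT then bitsToNat (factCode P.p)
  else valOf₂ ⟨P.p, P.g, P.a, P.b, (op P k).tag, 0, (op P k).L, (op P k).w1 P, regsBits P cfg ((op P k).r1 ++ (op P k).r2)⟩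

/-- The arithmetic value does not depend on the bit index of the query. [folklore] -/
theorem valOf₂_idx (p g a b tag idx L w₁ : ℕ) (regs : List Bool) :
    valOf₂ ⟨p, g, a, b, tag, idx, L, w₁, regs⟩ = valOf₂ ⟨p, g, a, b, tag, 0, L, w₁, regs⟩ := rfl

variable {P}

/-- Reading the sources of block `k`. [folklore] -/
theorem ofFn_lab_src (cfg : ℕ → ℕ) (k : ℕ) : List.ofFn (lab P cfg ∘ (xblock P k).src) = regsBits P cfg ((op P k).r1 ++ (op P k).r2) :=
  ofFn_lab_regsEmb P cfg _ _

/-- **The oracle answers gate `i` of block `k` with bit `i` of the block's value.**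
[cite: BennettBernsteinBrassardVazirani1997, Cor. 4.15] -/
theorem answer_eq {cfg : ℕ → ℕ} (h : HdrOK P cfg) {k : ℕ} (hk : k < 26) (i : Fin (wd P (op P k).dst)) :
    lang₂.boolIndicator (List.ofFn (lab P cfg ∘ (xblock P k).hdr i) ++ List.ofFn (lab P cfg ∘ (xblock P k).src)) = (opVal P cfg k).testBit i := by
  rw [ofFn_lab_hdr h hk i, ofFn_lab_src, hdrStr, ← encodeQ_append, boolIndicator_lang₂, opVal]
  by_cases ht : (op P k).tag = tagFACT
  · rw [if_pos ht, parse_encodeQ, specBit₂, if_pos ht, Complexity.testBit_bitsToNat_eq_getD]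
  · rw [if_neg ht, specBit₂_parse_encodeQ ht, valOf₂_idx]

/-! ### Writing and erasing -/

/-- Writing along the register embedding is writing along the segment embedding. [folklore] -/
theorem writeB_reg (r : R) (x : QReg (bw P)) (v : ℕ) :
    writeB (reg P r) x (fun i => v.testBit i) = writeB (emb (segs P) r.idx) x (fun i => v.testBit i) := by
  refine (KitaevEmb.eq_writeB_iff (emb (segs P) r.idx) x _ _).2 ⟨fun w hw => ?_, funext fun i => ?_⟩
  · apply writeB_apply_of_not_mem
    rintro ⟨i, rfl⟩
    exact hw ⟨Fin.cast (segs_getD_idx P r).symm i, by rw [reg_eq_emb]⟩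
  · show writeB (reg P r) x (fun i => v.testBit i) (emb (segs P) r.idx i) = v.testBit i
    have e : emb (segs P) r.idx i = reg P r (Fin.cast (segs_getD_idx P r) i) := by rw [reg_eq_emb]; rfl
    rw [e, writeB_apply_ws]
    rfl

/-- Writing the bits of `v` on the target of block `k` updates the contents. [folklore] -/
theorem writeB_dst_lab (cfg : ℕ → ℕ) (k v : ℕ) :
    writeB (xblock P k).dst (lab P cfg) (fun i => v.testBit i) = lab P (Function.update cfg (op P k).dst.idx v) := by
  have h1 : writeB (xblock P k).dst (lab P cfg) (fun i => v.testBit i) = writeB (emb (segs P) (op P k).dst.idx) (lab P cfg) (fun i => v.testBit i) :=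
    writeB_reg (op P k).dst (lab P cfg) v
  rw [h1, lab, writeB_emb_lay]
  rfl

/-- Clearing the target of block `k` updates the contents. [folklore] -/
theorem writeB_dst_lab_false (cfg : ℕ → ℕ) (k : ℕ) :
    writeB (xblock P k).dst (lab P cfg) (fun _ => false) = lab P (Function.update cfg (op P k).dst.idx 0) := by
  have e : (fun _ : Fin (wd P (op P k).dst) => false) = fun i : Fin (wd P (op P k).dst) => (0 : ℕ).testBit i := by
    funext i; rw [Nat.zero_testBit]
  have h1 : writeB (xblock P k).dst (lab P cfg) (fun _ => false) = writeB (xblock P k).dst (lab P cfg) (fun i : Fin (wd P (op P k).dst) => (0 : ℕ).testBit i) :=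
    congrArg _ e
  exact h1.trans (writeB_dst_lab cfg k 0)

/-- **Block `k` writes its value into a clean target.** [cite: BennettBernsteinBrassardVazirani1997, Cor. 4.15] -/
theorem run_xblock_of_clean {cfg : ℕ → ℕ} (h : HdrOK P cfg) {k : ℕ} (hk : k < 26) (hclean : cfg (op P k).dst.idx = 0) :
    OracleXor.run lang₂ (xblock P k).gates (lab P cfg) = lab P (Function.update cfg (op P k).dst.idx (opVal P cfg k)) := by
  have hw := (xblock P k).run_eq_writeB_of_clean lang₂ (lab P cfg) (fun i => (opVal P cfg k).testBit i)
    (fun i => by show lab P cfg (reg P (op P k).dst i) = false; rw [lab_reg, hclean, Nat.zero_testBit])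
    (fun i => answer_eq h hk i)
  rw [hw, writeB_dst_lab]

/-- **Block `k` clears a target holding its value** (the value depends only on the sources, which the
target is not among). [cite: Bennett1973, §2] -/
theorem run_xblock_of_written {cfg : ℕ → ℕ} (h : HdrOK P cfg) {k : ℕ} (hk : k < 26) (hval : cfg (op P k).dst.idx = opVal P cfg k) :
    OracleXor.run lang₂ (xblock P k).gates (lab P cfg) = lab P (Function.update cfg (op P k).dst.idx 0) := by
  have hw := (xblock P k).run_eq_writeB_of_written lang₂ (lab P cfg)
    (fun i => by rw [answer_eq h hk i]; show _ = lab P cfg (reg P (op P k).dst i); rw [lab_reg, hval])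
  rw [hw, writeB_dst_lab_false]

end VDSCopy

end Literature.Computability.Cryptography

end
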